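import Summits.QuantumFields.QCD.Theses.SeaNonGibbs
import Summits.QuantumFields.QCD.Theorems.SeaNonGibbsUniformLoopPotentialDet
import Summits.QuantumFields.QCD.Theorems.SeaNonGibbsUniformLoopPotentialAction
import HarnessLib

/-!
# Route `SeaNonGibbs` (QCD): the support item `UniformLoopPotential` (stmt-QuantumFields-8858)

REGIME (a), `κ < 1/8`: for every bare mass `m > 0` and every `N_f` there is `C` such that for every
real `β`, every four-torus, every link `e₀`, every radius `L` and every two `SU(3)` gauge fields
`U, U'` agreeing on the links `≠ e₀` within `ℓ¹` distance `L` of `e₀`, the single-link conditional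
laws at `e₀` of the unquenched weight `e^{−β S_W} |det D_W(·, m, 1)|^{N_f}` are within
`C · (4/(m+4))^{2L}` in total variation.

Proof. For `L ≥ 2` the gauge factor is exactly local (`wilsonAction_update_sub_eq`), and the
fermion determinant is quasi-local (`norm_det_update_le_and_ge`: the ratio
`|det D(U[e₀↦u])| / |det D(U'[e₀↦u])|` is pinched between `(1 ± δ)^{24} c` with `c` independent
of `u` and `δ ≍ θ^{2(L−1)}`, `θ = 4/(m+4)`), so the two conditional densities are proportional up
to a factor in `[(1−δ)^{24N_f}, (1+δ)^{24N_f}]` and the total-variation lemma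
(`integral_abs_sub_div_le`) gives `≤ ((1+δ)/(1−δ))^{24N_f} − 1 ≤ 2^{24N_f+2} δ`; for `L < 2` or
`δ > 1/4` the trivial bound `2` is absorbed into the constant. Nothing here bears on confinement or
the mass gap; no summit, leg or crux statement is proved (seat ym-line-fcl-p3 g19, free hands).
-/

noncomputable section

open Matrix Finset MeasureTheory
open Literature.Probability.LatticeModels (TorusSite)
open Literature.MathematicalPhysics.QuantumFieldTheory
open Literature.MathematicalPhysics.QuantumLattice

namespace Summit.QuantumFields.QCD.Theorems

namespace UniformLoopPotential

/-- Real arithmetic of the sandwich: from the determinant pinching and the exact gauge factor to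
`a c g ≤ f ≤ b c g`. -/
theorem sandwich_of_det_bounds {eU eU' eκ dU dU' cdet δ : ℝ} (Nf : ℕ) (heκ : 0 < eκ) (heU' : 0 < eU')
    (hcdet : 0 ≤ cdet) (hdU' : 0 ≤ dU') (hδ : δ ≤ 1) (hexp : eU = eκ * eU')
    (hlo : (1 - δ) ^ (8 * 3) * (cdet * dU') ≤ dU) (hhi : dU ≤ (1 + δ) ^ (8 * 3) * (cdet * dU')) :
    ((1 - δ) ^ (8 * 3)) ^ Nf * (eκ * cdet ^ Nf) * (eU' * dU' ^ Nf) ≤ eU * dU ^ Nf ∧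
      eU * dU ^ Nf ≤ ((1 + δ) ^ (8 * 3)) ^ Nf * (eκ * cdet ^ Nf) * (eU' * dU' ^ Nf) := by
  have h0 : 0 ≤ (1 - δ) ^ (8 * 3) * (cdet * dU') := by
    have : 0 ≤ 1 - δ := by linarith
    positivity
  have hlo' := pow_le_pow_left₀ h0 hlo Nf
  have hhi' := pow_le_pow_left₀ (h0.trans hlo) hhi Nf
  rw [mul_pow, mul_pow] at hlo' hhi'
  rw [hexp]
  have hpos : 0 ≤ eκ * eU' := by positivity
  constructor
  · calc ((1 - δ) ^ (8 * 3)) ^ Nf * (eκ * cdet ^ Nf) * (eU' * dU' ^ Nf)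
        = (eκ * eU') * (((1 - δ) ^ (8 * 3)) ^ Nf * (cdet ^ Nf * dU' ^ Nf)) := by ring
      _ ≤ (eκ * eU') * dU ^ Nf := mul_le_mul_of_nonneg_left hlo' hpos
      _ = eκ * eU' * dU ^ Nf := by ring
  · calc eκ * eU' * dU ^ Nf = (eκ * eU') * dU ^ Nf := by ring
      _ ≤ (eκ * eU') * (((1 + δ) ^ (8 * 3)) ^ Nf * (cdet ^ Nf * dU' ^ Nf)) :=
          mul_le_mul_of_nonneg_left hhi' hpos
      _ = ((1 + δ) ^ (8 * 3)) ^ Nf * (eκ * cdet ^ Nf) * (eU' * dU' ^ Nf) := by ring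

/-- Continuous real functions on `SU(3)` are Haar integrable. -/
theorem integrable_of_continuous_su3 {f : Matrix.specialUnitaryGroup (Fin 3) ℂ → ℝ}
    (hf : Continuous f) : Integrable f (haarProbability (Matrix.specialUnitaryGroup (Fin 3) ℂ)) := by
  obtain ⟨C, hC⟩ := (isCompact_univ.image (continuous_abs.comp hf)).isBounded.bddAbove
  refine (integrable_const C).mono' hf.aestronglyMeasurable (ae_of_all _ fun u => ?_)
  rw [Real.norm_eq_abs]
  exact hC ⟨u, Set.mem_univ _, rfl⟩

/-- A positive function has positive integral against the Haar probability measure. -/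
theorem integral_pos_su3 {f : Matrix.specialUnitaryGroup (Fin 3) ℂ → ℝ}
    (hfi : Integrable f (haarProbability (Matrix.specialUnitaryGroup (Fin 3) ℂ))) (hf : ∀ u, 0 < f u) :
    0 < ∫ u, f u ∂(haarProbability (Matrix.specialUnitaryGroup (Fin 3) ℂ)) := by
  rw [integral_pos_iff_support_of_nonneg (fun u => (hf u).le) hfi,
    show Function.support f = Set.univ from Set.eq_univ_of_forall fun u => (hf u).ne', measure_univ]
  exact one_pos

end UniformLoopPotential

open UniformLoopPotential in
/-- **Item stmt-QuantumFields-8858 `SeaNonGibbs.UniformLoopPotential` holds** (regime (a) of the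
route: for `κ = 1/(2m+8) < 1/8` the unquenched Wilson gauge marginal has uniformly quasilocal
single-link conditional laws, with rate `θ² = (4/(m+4))²` per unit of distance). -/
theorem seaNonGibbs_uniformLoopPotential_proof : Theses.SeaNonGibbs.UniformLoopPotential := by
  intro m hm Nf
  have hm4 : 0 < m + 4 := by linarith
  set θ : ℝ := 4 / (m + 4) with hθ
  have hθ0 : 0 < θ := by positivity
  have hθ1 : θ < 1 := by rw [hθ, div_lt_one hm4]; linarith
  have h1θ : 0 < 1 / (1 - θ) := one_div_pos.2 (by linarith)
  set Bδ : ℝ := (1 + (1 + θ) * (1 / (1 - θ))) * 8 * (8 * ((m + 4)⁻¹) ^ 2 * (1 / (1 - θ)) ^ 2)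
    with hBδ
  have hBδ0 : 0 ≤ Bδ := by positivity
  set K : ℕ := 8 * 3 * Nf with hK
  refine ⟨2 ^ (K + 2) * (Bδ / θ ^ 2) + 8 * (Bδ / θ ^ 2) + 2 / θ ^ 2, ?_⟩
  intro β n Λ w Z p e₀ U U' hUU'
  set ρ₃ := fundamentalRep (Fin 3) with hρ₃
  have hρu : ∀ g, ρ₃ g ∈ Matrix.unitaryGroup (Fin 3) ℂ := fundamentalRep_mem_unitaryGroup
  have hρc : Continuous ρ₃ := continuous_fundamentalRep (Fin 3)
  set μH := haarProbability (Matrix.specialUnitaryGroup (Fin 3) ℂ) with hμH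
  set f : Matrix.specialUnitaryGroup (Fin 3) ℂ → ℝ := fun u => w (Function.update U e₀ u) with hf
  set g : Matrix.specialUnitaryGroup (Fin 3) ℂ → ℝ := fun u => w (Function.update U' e₀ u) with hg
  have hfc : Continuous f := continuous_linkWeight ρ₃ hρc β m Nf U e₀
  have hgc : Continuous g := continuous_linkWeight ρ₃ hρc β m Nf U' e₀
  have hfpos : ∀ u, 0 < f u := fun u =>
    mul_pos (Real.exp_pos _) (pow_pos (norm_pos_iff.2 (wilsonDirac_det_ne_zero_of_pos ρ₃ hρu _ hm)) Nf)
  have hgpos : ∀ u, 0 < g u := fun u =>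
    mul_pos (Real.exp_pos _) (pow_pos (norm_pos_iff.2 (wilsonDirac_det_ne_zero_of_pos ρ₃ hρu _ hm)) Nf)
  have hfi : Integrable f μH := integrable_of_continuous_su3 hfc
  have hgi : Integrable g μH := integrable_of_continuous_su3 hgc
  have hZf : 0 < ∫ u, f u ∂μH := integral_pos_su3 hfi hfpos
  have hZg : 0 < ∫ u, g u ∂μH := integral_pos_su3 hgi hgpos
  -- what we must show, in the letters `f`, `g`
  suffices key : ∫ u, |f u / (∫ v, f v ∂μH) - g u / (∫ v, g v ∂μH)| ∂μH ≤
      (2 ^ (K + 2) * (Bδ / θ ^ 2) + 8 * (Bδ / θ ^ 2) + 2 / θ ^ 2) * θ ^ (2 * Λ) by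
    exact key
  have hTV2 : ∫ u, |f u / (∫ v, f v ∂μH) - g u / (∫ v, g v ∂μH)| ∂μH ≤ 2 :=
    integral_abs_sub_div_le_two μH hfi hgi (fun u => (hfpos u).le) (fun u => (hgpos u).le) hZf hZg
  have hθpow0 : 0 < θ ^ (2 * Λ) := pow_pos hθ0 _
  by_cases hgood : 2 ≤ Λ ∧ Bδ / θ ^ 2 * θ ^ (2 * Λ) ≤ 1 / 4
  · obtain ⟨hΛ2, hsmall⟩ := hgood
    -- the determinant pinching parameter
    set δ : ℝ := (1 + (1 + θ) * (1 / (1 - θ))) * 8 *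
      (8 * ((m + 4)⁻¹) ^ 2 * (θ ^ (Λ - 1) * (1 / (1 - θ))) ^ 2) with hδ
    have hδeq : δ = Bδ / θ ^ 2 * θ ^ (2 * Λ) := by
      have hpow : θ ^ (2 * Λ) = (θ ^ (Λ - 1)) ^ 2 * θ ^ 2 := by
        rw [← pow_mul, ← pow_add]; congr 1; omega
      rw [hpow, hδ, hBδ]
      field_simp
    have hδ0 : 0 ≤ δ := by rw [hδ]; positivity
    have hδ14 : δ ≤ 1 / 4 := hδeq ▸ hsmall
    have hδ1 : δ ≤ 1 := by linarith
    -- the gauge factor and the determinant ratio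
    set κ : ℝ := wilsonAction ρ₃ (Function.update U e₀ 1) - wilsonAction ρ₃ (Function.update U' e₀ 1)
      with hκ
    set cdet : ℝ := ‖(wilsonDirac ρ₃ (Function.update U e₀ 1) m 1).det‖ /
      ‖(wilsonDirac ρ₃ (Function.update U' e₀ 1) m 1).det‖ with hcdet
    have hcdet0 : 0 < cdet := div_pos (norm_pos_iff.2 (wilsonDirac_det_ne_zero_of_pos ρ₃ hρu _ hm))
      (norm_pos_iff.2 (wilsonDirac_det_ne_zero_of_pos ρ₃ hρu _ hm))
    have hc : 0 < Real.exp (-β * κ) * cdet ^ Nf := mul_pos (Real.exp_pos _) (pow_pos hcdet0 _)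
    have ha : 0 < ((1 - δ) ^ (8 * 3)) ^ Nf := pow_pos (pow_pos (by linarith) _) _
    have hab : ((1 - δ) ^ (8 * 3)) ^ Nf ≤ ((1 + δ) ^ (8 * 3)) ^ Nf :=
      pow_le_pow_left₀ (pow_nonneg (by linarith) _) (pow_le_pow_left₀ (by linarith) (by linarith) _) _
    have hflu : ∀ u, ((1 - δ) ^ (8 * 3)) ^ Nf * (Real.exp (-β * κ) * cdet ^ Nf) * g u ≤ f u ∧
        f u ≤ ((1 + δ) ^ (8 * 3)) ^ Nf * (Real.exp (-β * κ) * cdet ^ Nf) * g u := by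
      intro u
      obtain ⟨hlo, hhi⟩ := norm_det_update_le_and_ge ρ₃ hρu hm hUU' hδ1 u
      have hS := wilsonAction_update_sub_eq ρ₃ hΛ2 hUU' u 1
      have hexp : Real.exp (-β * wilsonAction ρ₃ (Function.update U e₀ u)) =
          Real.exp (-β * κ) * Real.exp (-β * wilsonAction ρ₃ (Function.update U' e₀ u)) := by
        rw [← Real.exp_add]; congr 1; rw [hκ, ← hS]; ring
      exact sandwich_of_det_bounds Nf (Real.exp_pos _) (Real.exp_pos _) hcdet0.le (norm_nonneg _) hδ1
        hexp hlo hhi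
    have hTV := integral_abs_sub_div_le μH hfi hgi hgpos hc ha hab (fun u => (hflu u).1)
      (fun u => (hflu u).2) hZg
    have hratio : ((1 + δ) ^ (8 * 3)) ^ Nf / ((1 - δ) ^ (8 * 3)) ^ Nf = ((1 + δ) / (1 - δ)) ^ K := by
      rw [hK, ← div_pow, ← div_pow, ← pow_mul]
    rw [hratio] at hTV
    calc _ ≤ ((1 + δ) / (1 - δ)) ^ K - 1 := hTV
      _ ≤ 2 ^ (K + 2) * δ := div_pow_sub_one_le hδ0 hδ14 K
      _ = 2 ^ (K + 2) * (Bδ / θ ^ 2) * θ ^ (2 * Λ) := by rw [hδeq]; ring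
      _ ≤ (2 ^ (K + 2) * (Bδ / θ ^ 2) + 8 * (Bδ / θ ^ 2) + 2 / θ ^ 2) * θ ^ (2 * Λ) := by
          have : 0 ≤ (8 * (Bδ / θ ^ 2) + 2 / θ ^ 2) * θ ^ (2 * Λ) := by positivity
          nlinarith
  · -- the trivial bound `2` is absorbed
    rw [not_and_or, not_le, not_le] at hgood
    refine hTV2.trans ?_
    rcases hgood with hΛ | hbig
    · -- `Λ ≤ 1`: `θ^{2Λ} ≥ θ²`
      have hpow : θ ^ 2 ≤ θ ^ (2 * Λ) := pow_le_pow_of_le_one hθ0.le hθ1.le (by omega)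
      calc (2 : ℝ) = 2 / θ ^ 2 * θ ^ 2 := by field_simp
        _ ≤ 2 / θ ^ 2 * θ ^ (2 * Λ) := by gcongr
        _ ≤ _ := by
          have : 0 ≤ (2 ^ (K + 2) * (Bδ / θ ^ 2) + 8 * (Bδ / θ ^ 2)) * θ ^ (2 * Λ) := by positivity
          nlinarith
    · -- `δ > 1/4`: `2 < 8 δ`
      calc (2 : ℝ) ≤ 8 * (Bδ / θ ^ 2 * θ ^ (2 * Λ)) := by linarith
        _ = 8 * (Bδ / θ ^ 2) * θ ^ (2 * Λ) := by ring
        _ ≤ _ := by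
          have : 0 ≤ (2 ^ (K + 2) * (Bδ / θ ^ 2) + 2 / θ ^ 2) * θ ^ (2 * Λ) := by positivity
          nlinarith

end Summit.QuantumFields.QCD.Theorems

end
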